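import Summits.ValiantsHypothesis.ValiantsHypothesis.Theorems.KPlusLogSqLawTropicalBConvexPositionDefs
import Summits.ValiantsHypothesis.ValiantsHypothesis.Theorems.KPlusLogSqLawTropicalBNewtonPolygon
import Summits.ValiantsHypothesis.ValiantsHypothesis.Theorems.LacunarySymmetroidMatrixDescartesCensusTropicalKLawSlopes

/-!
# Route «KPlusLogSqLaw», crux `TropicalB` (stmt-ValiantsHypothesis-19771) — CONVEX POSITION OF THE DOMINANT SET, part 2:
# the Sidon (parallelogram) law

HONEST FRAMING.  Helper file of the object-search cell `pub-symmetroid` (seat val-sym-trop-p2 g3) for the crux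
`Summit.ValiantsHypothesis.ValiantsHypothesis.Theses.KPlusLogSqLaw.TropicalB` (ledger item `stmt-ValiantsHypothesis-19771`, route
`KPlusLogSqLaw`; registered stubs `stub_tropThin` / `stub_tropFat` of `Cruxes/TropicalB/Lines/birth.lean`, each ⟺ the crux), landed
`--supports`; it does NOT close the item and asserts nothing about `TropicalB` in its window, `WeakLifting`, `KPlusLogSqLaw`,
`MatrixDescartes` (stmt-ValiantsHypothesis-18050) or `VP ≠ VNP`.  Everything below is a STRUCTURAL fact about terms that are unique
optima (`IsDominant`) of an ARBITRARY dominance design `(d, v, ε)` of an arbitrary format `(m, K)`: no support class, no exponent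
regime, no sign condition, and — for the Sidon law — no chain.

THE POINT OF VIEW.  Part 1 (`…ConvexPositionDefs`) reads a term `p = (σ, λ)` as its multiset `inc p` of incidences `(σ b, b, λ b)` — a
`0/1` vector on entries × classes — on which both coordinates of the cell's normal form of the crux (`…TropicalBVertexCount`: `TropicalB`
⟺ at most `2^{C(K+⌊log₂ m⌋²)}` single-term vertices of the upper hull of the planar point set `{(Σ_b d(λ b), −Σ_b v(σ b, b, λ b))}`) are
LINEAR (`tropWeight_eq_ev`).  The terms dominant at some slope are points in STRICTLY CONVEX POSITION with pairwise distinct abscissae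
(here: `below_chord`, in the tree's Newton-polygon coordinates `IntervalOpt.sl d univ` / `IntervalOpt.cst v univ` of `…TropicalBNewtonPolygon`).  Hence a linear relation
`Σ_k α_k · inc p_k = 0` among dominant terms is an affine relation among the vertices of a convex polygon read along its boundary, and such
relations are rare: their sign pattern, read in slope order, changes sign at least three times.  This file proves the four-term instance and its
combinatorial corollaries; part 3 proves the arc law.

RESULTS.
* `ConvexPosition.sidon` — **SIDON (B₂) LAW, chain-free**: if `a, b, c, e` are dominant (each at its own integer slope; no hypothesis
  relates the four slopes) and `inc a + inc e = inc b + inc c` as multisets, then `{a, e} = {b, c}`.  Read as differences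
  (`ConvexPosition.exchange_unique`): NO EXCHANGE VECTOR RECURS IN THE DOMINANT SET — if the passage `a ↦ b` removes and adds the same
  incidences (with multiplicity) as the passage `c ↦ e`, then `(a, b) = (c, e)` or both passages are trivial.  (Compare val-sym-trop-p5's
  `exchange_fresh`, `…TropicalBFreshExchanges`: a labeled exchange is performed by at most one STEP of a dominant CHAIN; here the four
  terms need not be consecutive, need not lie on a common sign-alternating chain, and the statement is symmetric under `b ↔ c`.)  Proof:
  the affine functions `θ ↦ wt_θ(a) − wt_θ(b) = wt_θ(c) − wt_θ(e)` and `θ ↦ wt_θ(a) − wt_θ(c) = wt_θ(b) − wt_θ(e)` would have to separate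
  the four slopes in two incompatible ways (a parallelogram has no four exposed upper vertices).
* `ConvexPosition.parallelogram_free` — the column-wise form: if four dominant terms are such that in every column `e` carries the datum
  of `c` where `a` carries the datum of `b`, and the datum of `b` where `a` carries the datum of `c`, then `a = b` or `a = c`.  In words:
  TWO MODIFICATIONS OF A DOMINANT TERM ON DISJOINT COLUMN SETS ARE NEVER DOMINANT TOGETHER WITH THEIR JOINT APPLICATION — no `2 × 2` grid
  of independent switches (cycle sets, class flips, or both) inside the dominant set.  This is the qualitative core of every «autonomous
  registers meet additively» row of the cell (direct sums, torus, block cuts — there the grid is forced by the product structure),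
  support-free.
* `ConvexPosition.no_midpoint` — no dominant term is the midpoint of two others (`2·inc a = inc b + inc c ⇒ a = b = c`).
* (part 3, `…TropicalBConvexPositionArc`: `below_chord` — strict convexity in the `(slope, valuation)` plane — and the **ARC LAW**: along a
  dominant chain no conic combination of the incidence multisets of an ARC equals a conic combination, of the same total weight, of the
  incidence multisets of the terms OUTSIDE the arc; sign patterns `+ − +` and `+ −` do not occur.)

RELATION TO THE TREE (cite these, the mechanism is the same: a sum of dominance inequalities in which the valuations cancel).
val-sym-lift-p1 g3's re-decomposition / majorization law `TropicalCensus.sum_mul_slope_lt_of_redecomp` and its pair form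
`TropicalCensus.slope_lt_of_resplit` (`…Theorems.KPlusLogSqLawTropicalExchange`) compare a dominant family with an ARBITRARY column-wise
re-decomposition of it and conclude a strict SLOPE inequality («exchanges may concentrate slope, never spread it»); the Sidon law is the
corollary of two applications of the pair form in which the re-decomposition is itself dominant, and the arc law is the corollary of the
majorization law plus a rearrangement argument (terms outside an arc are more spread in slope than the arc).  The proofs below are direct
(the chord functional of strict convexity, `below_chord`) and import neither; what this file adds is the incidence-multiset currency of
part 1, the chain-free four-term statement with no slope hypotheses, the column-wise parallelogram / grid exclusion, and the
non-existence form for weighted arcs.  Cyclewise monotonicity (`sum_d_lt_of_isDominant_invariant`, `…TropicalCycleMonotone`) and the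
sub-additivity of restricted optima (`IntervalOpt.card_optRestr_union_le`) are the other two kernel forms of the same circle of ideas.

READING FOR THE CRUX (located, refuter calibration; nothing here bounds `TropicalB`): for a fixed design the dominant terms sorted by slope
form a chain, so the dominant set of a hypothetical counterexample family is a Sidon family of `0/1` vectors every slope-arc of which is
linearly separable from its complement by an entry-class weight table; pairwise differences `inc p − inc q` over the dominant set are
pairwise distinct, and no product-like sub-structure (two commuting independent modifications) is ever fully dominant.
[folklore: affine dependencies of points in convex position; the packaging for dominance designs is the cell's]
-/

-- `Summit.ValiantsHypothesis.ValiantsHypothesis.…` repeats a component by the D-0017 layout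
-- (single-conjunct summit), which the `dupNamespace` linter flags; the name is mandated.
set_option linter.dupNamespace false
set_option autoImplicit false

namespace Summit.ValiantsHypothesis.ValiantsHypothesis.Theorems.KPlusLogSqLaw

open Summit.ValiantsHypothesis.ValiantsHypothesis.Theorems.MatrixDescartes.Negative
open Summit.ValiantsHypothesis.ValiantsHypothesis.Theorems.LacunarySymmetroidMatrixDescartes
open scoped BigOperators
open Finset

namespace ConvexPosition

variable {m K : ℕ}

/-! ## 1. Newton-polygon coordinates as evaluations -/

/-- the slope `IntervalOpt.sl d univ` is the evaluation of the exponent table. [folklore] -/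
theorem ev_d_eq_sl (d : Fin K → ℕ) (p : Equiv.Perm (Fin m) × (Fin m → Fin K)) :
    ev (fun x => (d x.2.2 : ℤ)) p = IntervalOpt.sl d univ p := by
  rw [ev_eq_sum]; rfl

/-- the valuation `IntervalOpt.cst v univ` is the evaluation of the valuation table. [folklore] -/
theorem ev_v_eq_cst (v : Fin m → Fin m → Fin K → ℤ) (p : Equiv.Perm (Fin m) × (Fin m → Fin K)) :
    ev (fun x => v x.1 x.2.1 x.2.2) p = IntervalOpt.cst v univ p := by
  rw [ev_eq_sum]; rfl

/-! ## 2. The Sidon (parallelogram) law — four dominant terms, no chain -/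

section Sidon

variable (d : Fin K → ℕ) (v ε : Fin m → Fin m → Fin K → ℤ)

/-- **SIDON LAW.**  Four terms, each the unique optimum of the design at some integer slope, whose incidence multisets satisfy
`inc a + inc e = inc b + inc c`, are two pairs: `{a, e} = {b, c}`.  No hypothesis relates the four slopes. [folklore] -/
theorem sidon {θa θb θc θe : ℤ} {a b c e : Equiv.Perm (Fin m) × (Fin m → Fin K)}
    (ha : IsDominant d v ε θa a) (hb : IsDominant d v ε θb b) (hc : IsDominant d v ε θc c)
    (he : IsDominant d v ε θe e) (hrel : inc a + inc e = inc b + inc c) :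
    (a = b ∧ e = c) ∨ (a = c ∧ e = b) := by
  classical
  -- the weight identity `wt a + wt e = wt b + wt c` at every slope
  have hwt : ∀ θ : ℤ, tropWeight d v θ a + tropWeight d v θ e = tropWeight d v θ b + tropWeight d v θ c := by
    intro θ
    simp only [tropWeight_eq_ev]
    exact ev_add_eq_of_inc_add_eq hrel _
  -- degenerate coincidences
  by_cases hab : a = b
  · subst hab
    left
    refine ⟨rfl, inc_injective ?_⟩
    exact add_left_cancel hrel
  by_cases hac : a = c
  · subst hac
    right
    refine ⟨rfl, inc_injective ?_⟩
    rw [add_comm (inc b)] at hrel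
    exact add_left_cancel hrel
  have heb : e ≠ b := by
    rintro rfl
    apply hac
    apply inc_injective
    rw [add_comm (inc a)] at hrel
    exact add_left_cancel hrel
  have hec : e ≠ c := by
    rintro rfl
    apply hab
    apply inc_injective
    rw [add_comm (inc a), add_comm (inc b)] at hrel
    exact add_left_cancel hrel
  exfalso
  -- the eight strict comparisons
  have h1 := ha.2 b (Ne.symm hab) hb.1
  have h2 := ha.2 c (Ne.symm hac) hc.1
  have h3 := hb.2 a hab ha.1
  have h4 := hb.2 e heb he.1
  have h5 := hc.2 a hac ha.1
  have h6 := hc.2 e hec he.1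
  have h7 := he.2 b (Ne.symm heb) hb.1
  have h8 := he.2 c (Ne.symm hec) hc.1
  have ia := hwt θa
  have ib := hwt θb
  have ic := hwt θc
  have ie := hwt θe
  simp only [NewtonPolygon.tropWeight_eq_sl_sub_cst d v] at h1 h2 h3 h4 h5 h6 h7 h8 ia ib ic ie
  -- g(θ) = wt a − wt b is affine in θ with coefficient P;  h(θ) = wt a − wt c with coefficient P'
  set Sa := IntervalOpt.sl d univ a
  set Sb := IntervalOpt.sl d univ b
  set Sc := IntervalOpt.sl d univ c
  set Se := IntervalOpt.sl d univ e
  set Va := IntervalOpt.cst v univ a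
  set Vb := IntervalOpt.cst v univ b
  set Vc := IntervalOpt.cst v univ c
  set Ve := IntervalOpt.cst v univ e
  -- g > 0 at θa, θc and g < 0 at θb, θe;  h > 0 at θa, θb and h < 0 at θc, θe
  have g1 : (Sa - Sb) * (θa - θe) > 0 := by nlinarith
  have g2 : (Sa - Sb) * (θc - θb) > 0 := by nlinarith
  have k1 : (Sa - Sc) * (θa - θe) > 0 := by nlinarith
  have k2 : (Sa - Sc) * (θb - θc) > 0 := by nlinarith
  have x1 : (θa - θe) * (θc - θb) > 0 := by
    by_contra hx
    push Not at hx
    have := mul_pos g1 g2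
    nlinarith [sq_nonneg (Sa - Sb)]
  have x2 : (θa - θe) * (θb - θc) > 0 := by
    by_contra hx
    push Not at hx
    have := mul_pos k1 k2
    nlinarith [sq_nonneg (Sa - Sc)]
  nlinarith

/-- **No midpoints.**  A dominant term is never the midpoint of two dominant terms: `2·inc a = inc b + inc c ⇒ a = b = c`. [folklore] -/
theorem no_midpoint {θa θb θc : ℤ} {a b c : Equiv.Perm (Fin m) × (Fin m → Fin K)}
    (ha : IsDominant d v ε θa a) (hb : IsDominant d v ε θb b) (hc : IsDominant d v ε θc c)
    (hrel : 2 • inc a = inc b + inc c) : a = b ∧ a = c := by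
  rw [two_nsmul] at hrel
  rcases sidon d v ε ha hb hc ha hrel with ⟨h1, h2⟩ | ⟨h1, h2⟩
  · exact ⟨h1, h2⟩
  · exact ⟨h2, h1⟩

/-- **PARALLELOGRAM (GRID) EXCLUSION.**  Four dominant terms forming a column-wise parallelogram — in every column `e` carries the
datum of `c` where `a` carries the datum of `b`, and the datum of `b` where `a` carries the datum of `c` (so `b` and `c` modify `a` on
disjoint column sets and `e` is their joint application) — are degenerate: `a = b` or `a = c`.  Two independent modifications of a
dominant term are never both dominant together with their composite. [folklore] -/
theorem parallelogram_free {θa θb θc θe : ℤ} {a b c e : Equiv.Perm (Fin m) × (Fin m → Fin K)}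
    (ha : IsDominant d v ε θa a) (hb : IsDominant d v ε θb b) (hc : IsDominant d v ε θc c)
    (he : IsDominant d v ε θe e)
    (hcol : ∀ j, ((a.1 j, a.2 j) = (b.1 j, b.2 j) ∧ (e.1 j, e.2 j) = (c.1 j, c.2 j)) ∨
      ((a.1 j, a.2 j) = (c.1 j, c.2 j) ∧ (e.1 j, e.2 j) = (b.1 j, b.2 j))) :
    a = b ∨ a = c := by
  rcases sidon d v ε ha hb hc he (inc_add_eq_of_colwise hcol) with ⟨h, -⟩ | ⟨h, -⟩
  · exact Or.inl h
  · exact Or.inr h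

/-- **No exchange recurs in the dominant set** (the Sidon law read as differences): if the passages `a ↦ b` and `c ↦ e` between
dominant terms have the same incidence bookkeeping, `inc a + inc e = inc b + inc c` (what `a ↦ b` removes and adds, with multiplicity,
is what `c ↦ e` removes and adds), then either the two passages coincide (`a = c`, `b = e`) or both are trivial (`a = b`, `c = e`).
[folklore] -/
theorem exchange_unique {θa θb θc θe : ℤ} {a b c e : Equiv.Perm (Fin m) × (Fin m → Fin K)}
    (ha : IsDominant d v ε θa a) (hb : IsDominant d v ε θb b) (hc : IsDominant d v ε θc c)
    (he : IsDominant d v ε θe e) (hrel : inc a + inc e = inc b + inc c) :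
    (a = c ∧ b = e) ∨ (a = b ∧ c = e) := by
  rcases sidon d v ε ha hb hc he hrel with ⟨h1, h2⟩ | ⟨h1, h2⟩
  · exact Or.inr ⟨h1, h2.symm⟩
  · exact Or.inl ⟨h1, h2.symm⟩

end Sidon

end ConvexPosition

end Summit.ValiantsHypothesis.ValiantsHypothesis.Theorems.KPlusLogSqLaw
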